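import Summits.HubbardSuperconductivity.HubbardSuperconductivity.Theorems.AnisotropyChordTransferFibre3FinXDPiHatY
import Summits.HubbardSuperconductivity.HubbardSuperconductivity.Theorems.AnisotropyChordTransferFibre3FinXDGlueDefs
import Summits.HubbardSuperconductivity.HubbardSuperconductivity.Theorems.AnisotropyChordTransferFibre3RowDMonoTransform

/-!
# Route `AnisotropyChord` / H0 rotor rung: FIN per-`L` row-D evaluator XD — soundness layer 2c: the direction sums `FTW/f_nn`, `Bd/f_nn`

The key-completeness check of the momentum lists (`keysOK`, decided once; `xdLow_keys`), integer momentum arithmetic on the torus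
(`toTor_moms`), the direction summands of `FTWfun`/`Bdfun` (`ftwTerm`, `bdTerm`, `ftw_bd_dirs`: `nnList` = the four `eDir`), and
★ `cmem_ftwBdDir` / `cmem_ftwBd`: the evaluator's `ftwBd` encloses `FTW/f_nn` and `Bd/f_nn` at every low `k` for every ground profile of
the cell (`cmem_Y`, `cmem_phN`, `cmem_wf`).  Prover seat `hubbard-h0-rotor-p3` g7; helper for piece A = stmt-HubbardSuperconductivity-23918
of rung 19089 (`--supports`, helper class).  WHAT THIS IS NOT: nothing here proves superconductivity in the Hubbard model (rotor TARGET as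
worded stays FALSE, g15 verdict); evaluator soundness for the FIN certificates of ONE conditional reduction.  Tree imports only; no sorry.
-/

set_option linter.dupNamespace false
set_option autoImplicit false

namespace Summit.HubbardSuperconductivity.HubbardSuperconductivity.Theorems.AnisotropyChord.Transfer.Fibre3

namespace FinXD

open scoped BigOperators
open Finset Hole2 FinCell FinXB RowD L2.N1

section cell

variable {L : ℕ} [NeZero L] {Δ lam2 : ℝ} {f : Tor L → ℝ} {la lb : ℤ} (H : XDHyp (L := L) Δ lam2 f la lb)
include H

/-! ## The direction sums -/

omit [NeZero L] H in
/-- integer momentum arithmetic read on the torus. [folklore] -/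
theorem toTor_moms (k : (ℤ × ℤ) × (ℤ × ℤ)) :
    B1.toTor L (k.1.1 - 1, k.1.2) = B1.toTor L k.1 - K1 L ∧
    B1.toTor L (k.2.1 - 1, k.2.2) = B1.toTor L k.2 - K1 L ∧
    B1.toTor L (k.1.1 + k.2.1, k.1.2 + k.2.2) = B1.toTor L k.1 + B1.toTor L k.2 ∧
    B1.toTor L (k.1.1 + k.2.1 - 1, k.1.2 + k.2.2) = B1.toTor L k.1 + B1.toTor L k.2 - K1 L ∧
    B1.toTor L (1 - k.1.1 - k.2.1, -k.1.2 - k.2.2) = K1 L - B1.toTor L k.1 - B1.toTor L k.2 := by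
  unfold B1.toTor K1
  simp only [Prod.mk_sub_mk, Prod.mk_add_mk, Prod.mk.injEq]
  push_cast
  refine ⟨⟨by ring, by ring⟩, ⟨by ring, by ring⟩, ⟨by ring, by ring⟩, ⟨by ring, by ring⟩, ⟨by ring, by ring⟩⟩

omit H in
/-- `FTW = f_nn · Σ_j ftwTerm (eDir j)`, `Bd = f_nn · Σ_j bdTerm (eDir j)`. [folklore] -/
theorem ftw_bd_dirs (k₂ k₃ : Tor L) :
    FTWfun L f k₂ k₃ = (f (K1 L) : ℂ) * (ftwTerm L f k₂ k₃ (eDir L 0) + ftwTerm L f k₂ k₃ (eDir L 1)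
      + ftwTerm L f k₂ k₃ (eDir L 2) + ftwTerm L f k₂ k₃ (eDir L 3)) ∧
    Bdfun L f k₂ k₃ = (f (K1 L) : ℂ) * (bdTerm L f k₂ k₃ (eDir L 0) + bdTerm L f k₂ k₃ (eDir L 1)
      + bdTerm L f k₂ k₃ (eDir L 2) + bdTerm L f k₂ k₃ (eDir L 3)) := by
  have e0 : eDir L 0 = ex L := by unfold eDir; simp
  have e1 : eDir L 1 = -ex L := by unfold eDir; simp
  have e2 : eDir L 2 = ey L := by unfold eDir; simp
  have e3 : eDir L 3 = -ey L := by unfold eDir; simp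
  rw [e0, e1, e2, e3]
  unfold FTWfun Bdfun
  rw [nnList_map_sum_complex, nnList_map_sum_complex]
  unfold ftwTerm bdTerm
  constructor <;> ring

/-- ★ the direction summands are enclosed: `ftwTerm (eDir j) ∈ (C.ftwBdDir k j).1`, `bdTerm (eDir j) ∈ (C.ftwBdDir k j).2`. [folklore] -/
theorem cmem_ftwBdDir {k : (ℤ × ℤ) × (ℤ × ℤ)} (hk : k ∈ xdLow) {j : ℕ} (hj : j < 4) :
    cmem (ftwTerm L f (B1.toTor L k.1) (B1.toTor L k.2) (eDir L j)) ((xdC L la lb).ftwBdDir k j).1 ∧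
    cmem (bdTerm L f (B1.toTor L k.1) (B1.toTor L k.2) (eDir L j)) ((xdC L la lb).ftwBdDir k j).2 := by
  have hL3 := H.cellHyp.hL3
  have hC := xdC_fields L la lb
  obtain ⟨-, hy⟩ := xdLow_keys k hk
  obtain ⟨m1, m2, m3, m4, -⟩ := toTor_moms (L := L) k
  have hjn : (if j = 0 then 1 else if j = 1 then 0 else if j = 2 then 3 else 2) < 4 := by split_ifs <;> omega
  have hneg := eDir_neg L hj
  -- the `Y` values
  have y := fun (i : ℕ) (hi : i < 4) (q : ℤ × ℤ) (hq : q ∈ ymoms k) => cmem_Y H hi (hy q hq).1 (hy q hq).2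
  have hq1 : k.1 ∈ ymoms k := by simp [ymoms]
  have hq2 : k.2 ∈ ymoms k := by simp [ymoms]
  have hq3 : (k.1.1 - 1, k.1.2) ∈ ymoms k := by simp [ymoms]
  have hq4 : (k.2.1 - 1, k.2.2) ∈ ymoms k := by simp [ymoms]
  have hq5 : (k.1.1 + k.2.1, k.1.2 + k.2.2) ∈ ymoms k := by simp [ymoms]
  have hq6 : (k.1.1 + k.2.1 - 1, k.1.2 + k.2.2) ∈ ymoms k := by simp [ymoms]
  have Y2 := y j hj _ hq1
  have Y3 := y j hj _ hq2
  have Y2m := y j hj _ hq3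
  have Y3m := y j hj _ hq4
  have Y23 := y _ hjn _ hq5
  have Y23m := y _ hjn _ hq6
  rw [m1] at Y2m
  rw [m2] at Y3m
  rw [m3, ← hneg] at Y23
  rw [m4, ← hneg] at Y23m
  have c2 := cmem_phN L hL3 (xdC L la lb) hC.1 hC.2.1 hC.2.2.1 j k.1
  have c3 := cmem_phN L hL3 (xdC L la lb) hC.1 hC.2.1 hC.2.2.1 j k.2
  have w := cmem_wf L hL3 (xdC L la lb) hC.1 hC.2.1 hC.2.2.1 j
  unfold XDCell.ftwBdDir
  constructor
  · unfold ftwTerm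
    exact cmem_cadd (cmem_cadd (cmem_cmul c2 (cmem_cadd (cmem_cmul w Y3) Y3m)) (cmem_cmul c3 (cmem_cadd (cmem_cmul w Y2) Y2m)))
      (cmem_cmul c3 (cmem_cadd Y23 (cmem_cmul w Y23m)))
  · have e : bdTerm L f (B1.toTor L k.1) (B1.toTor L k.2) (eDir L j)
        = ((1 + phase L (K1 L) (eDir L j)) * (Yfun L f (eDir L j) (B1.toTor L k.1) + Yfun L f (eDir L j) (B1.toTor L k.2))
            + Yfun L f (eDir L j) (B1.toTor L k.1 - K1 L))
          + (Yfun L f (eDir L j) (B1.toTor L k.2 - K1 L) + Yfun L f (-eDir L j) (B1.toTor L k.1 + B1.toTor L k.2))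
          + (1 + phase L (K1 L) (eDir L j)) * Yfun L f (-eDir L j) (B1.toTor L k.1 + B1.toTor L k.2 - K1 L) := by
      unfold bdTerm; ring
    rw [e]
    exact cmem_cadd (cmem_cadd (cmem_cadd (cmem_cmul w (cmem_cadd Y2 Y3)) Y2m) (cmem_cadd Y3m Y23)) (cmem_cmul w Y23m)

/-- ★ `FTW/f_nn ∈ (C.ftwBd k).1`, `Bd/f_nn ∈ (C.ftwBd k).2`. [folklore] -/
theorem cmem_ftwBd {k : (ℤ × ℤ) × (ℤ × ℤ)} (hk : k ∈ xdLow) :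
    cmem (ftwTerm L f (B1.toTor L k.1) (B1.toTor L k.2) (eDir L 0) + ftwTerm L f (B1.toTor L k.1) (B1.toTor L k.2) (eDir L 1)
      + ftwTerm L f (B1.toTor L k.1) (B1.toTor L k.2) (eDir L 2) + ftwTerm L f (B1.toTor L k.1) (B1.toTor L k.2) (eDir L 3))
      ((xdC L la lb).ftwBd k).1 ∧
    cmem (bdTerm L f (B1.toTor L k.1) (B1.toTor L k.2) (eDir L 0) + bdTerm L f (B1.toTor L k.1) (B1.toTor L k.2) (eDir L 1)
      + bdTerm L f (B1.toTor L k.1) (B1.toTor L k.2) (eDir L 2) + bdTerm L f (B1.toTor L k.1) (B1.toTor L k.2) (eDir L 3))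
      ((xdC L la lb).ftwBd k).2 := by
  have h0 := cmem_ftwBdDir H hk (show 0 < 4 by norm_num)
  have h1 := cmem_ftwBdDir H hk (show 1 < 4 by norm_num)
  have h2 := cmem_ftwBdDir H hk (show 2 < 4 by norm_num)
  have h3 := cmem_ftwBdDir H hk (show 3 < 4 by norm_num)
  unfold XDCell.ftwBd
  simp only [List.range, List.range.loop, List.map, List.foldr]
  constructor
  · have e : ∀ a b c d : ℂ, a + b + c + d = a + (b + (c + (d + 0))) := fun a b c d => by ring
    rw [e]
    exact cmem_cadd h0.1 (cmem_cadd h1.1 (cmem_cadd h2.1 (cmem_cadd h3.1 cmem_czero)))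
  · have e : ∀ a b c d : ℂ, a + b + c + d = a + (b + (c + (d + 0))) := fun a b c d => by ring
    rw [e]
    exact cmem_cadd h0.2 (cmem_cadd h1.2 (cmem_cadd h2.2 (cmem_cadd h3.2 cmem_czero)))

end cell

end FinXD

end Summit.HubbardSuperconductivity.HubbardSuperconductivity.Theorems.AnisotropyChord.Transfer.Fibre3
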